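import Mathlib
import Literature.Computability.AlgebraicComplexity.CommutativeExtensionSimulation
import Literature.Computability.AlgebraicComplexity.ArithCircuitProofs
import HarnessLib

/-!
# Weil restriction of scalars for circuit complexity: `L_F(f) ≤ 16 [E:F]³ · L_E(f)`

For a finite extension of fields `F ⊆ E` of degree `d` and a polynomial `f ∈ F[x_σ]`, the
fan-in-two circuit complexity over `F` is at most `16 d³` times the complexity over `E` of
`f ⊗_F E`: simulate `E`-arithmetic in coordinates of an `F`-basis (a product costs `O(d³)` via the
structure constants) and read off the coefficient of `1`. This is the field-extension case of the
Hrubeš–Yehudayoff simulation of commutative extension algebras (*Arithmetic complexity in ring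
extensions*, Theory of Computing 7 (2011), Thm 4.2), which the tree holds in the form
`CommExtSim.complexity_lmap_le`:
`L_k(φ(G)) ≤ (5d³ + 6d² + 2d) · L_R(G) + 3d` for a free `k`-algebra `R` of rank `d` and a
`k`-linear functional `φ` applied coefficientwise.

* `complexity_le_finrank_pow_three_mul_fin` — the bound for finitely many variables (`Fin n`);
* `complexity_le_finrank_pow_three_mul` — the bound for an arbitrary variable type (reduce to the
  finitely many variables that occur, `exists_fin_rename`).

The same derivation was first written route-side in
`Summits/ValiantsHypothesis/ValiantsHypothesis/Theorems/GaugeDescentScalarRestriction.lean`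
(item `GaugeDescent.ScalarRestriction`); this is its route-independent home, so that users need not
import a Theses cone. Not here: better constants (`O(d log d)` via fast multiplication), towers.

## References
* P. Hrubeš, A. Yehudayoff, *Arithmetic complexity in ring extensions*, Theory of Computing 7
  (2011) 119–129, Thm 4.2. [HrubesYehudayoff2011]
* P. Bürgisser, *Completeness and Reduction in Algebraic Complexity Theory*, Springer 2000, §4.1
  (Valiant's classes under field extensions). [Burgisser2000]
-/

noncomputable section

open MvPolynomial

namespace Literature.Computability.AlgebraicComplexity

/-- A polynomial of circuit complexity `0` is a variable or a constant (a circuit without gates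
outputs an input operand; a dangling gate reference evaluates to `0 = C 0`). [folklore] -/
private theorem eq_X_or_eq_C_of_complexity_eq_zero {k : Type*} [CommSemiring k] {σ : Type*}
    (G : MvPolynomial σ k) (hG : complexity G = 0) :
    (∃ i, G = X i) ∨ (∃ c, G = C c) := by
  obtain ⟨P, -, hP2, hP3⟩ := ArithCircuit.exists_computes_size_eq_complexity G
  rw [hG, ArithCircuit.size, List.length_eq_zero_iff] at hP3
  rw [ArithCircuit.Computes, ArithCircuit.eval, hP3] at hP2
  rw [← hP2]
  cases P.output with
  | var i => exact Or.inl ⟨i, rfl⟩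
  | const c => exact Or.inr ⟨c, rfl⟩
  | gate j =>
    refine Or.inr ⟨0, ?_⟩
    simp only [ArithCircuit.Operand.eval, ArithCircuit.gateValues, List.foldl_nil,
      List.getD_eq_getElem?_getD, List.getElem?_nil, Option.getD_none, C_0]

/-- If `f ⊗_F E` has complexity `0` over `E` then `f` has complexity `0` over `F`. [folklore] -/
private theorem complexity_eq_zero_of_map {F E : Type*} [Field F] [Field E] [Algebra F E]
    {σ : Type*} (f : MvPolynomial σ F)
    (h : complexity (MvPolynomial.map (algebraMap F E) f) = 0) : complexity f = 0 := by
  classical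
  rcases eq_X_or_eq_C_of_complexity_eq_zero _ h with ⟨i, hi⟩ | ⟨c, hc⟩
  · have : f = X i :=
      MvPolynomial.map_injective (algebraMap F E) (algebraMap F E).injective (by rw [hi, map_X])
    rw [this]
    exact complexity_X_holds i
  · have : f = C (coeff 0 f) := by
      ext m
      by_cases hm : m = 0
      · rw [hm, coeff_zero_C]
      · rw [coeff_C, if_neg (Ne.symm hm)]
        apply (algebraMap F E).injective
        rw [map_zero, ← coeff_map, hc, coeff_C, if_neg (Ne.symm hm)]
    rw [this]
    exact complexity_C_holds _

/-- **Restriction of scalars, finitely many variables**: for a finite field extension `E/F` and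
`q ∈ F[x_1..x_n]`, `L_F(q) ≤ 16 [E:F]³ L_E(q ⊗ E)` (Hrubeš–Yehudayoff 2011 Thm 4.2 with `R = E`
and a functional `φ` with `φ(1) = 1`). [cite: HrubesYehudayoff2011, Thm 4.2] -/
theorem complexity_le_finrank_pow_three_mul_fin {F E : Type*} [Field F] [Field E] [Algebra F E]
    [FiniteDimensional F E] {n : ℕ} (q : MvPolynomial (Fin n) F) :
    complexity q ≤ 16 * Module.finrank F E ^ 3 *
      complexity (MvPolynomial.map (algebraMap F E) q) := by
  classical
  -- a functional with `φ 1 = 1`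
  obtain ⟨ψ, hψ⟩ : ∃ ψ : Module.Dual F E, ψ 1 ≠ 0 := by
    by_contra h
    push Not at h
    exact one_ne_zero ((Module.forall_dual_apply_eq_zero_iff F (1 : E)).1 h)
  set φ : E →ₗ[F] F := (ψ 1)⁻¹ • ψ with hφ
  have hφ1 : φ 1 = 1 := by
    simp only [hφ, LinearMap.smul_apply, smul_eq_mul, inv_mul_cancel₀ hψ]
  have hq : CommExtSim.lmap φ (MvPolynomial.map (algebraMap F E) q) = q := by
    have h := CommExtSim.lmap_C_mul_map φ (1 : E) q
    rwa [C_1, one_mul, hφ1, one_smul] at h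
  have hmain := CommExtSim.complexity_lmap_le (Module.finBasis F E) φ
    (MvPolynomial.map (algebraMap F E) q)
  rw [hq, Fintype.card_fin] at hmain
  set d := Module.finrank F E with hd
  set L := complexity (MvPolynomial.map (algebraMap F E) q) with hL
  rcases Nat.eq_zero_or_pos L with h0 | hpos
  · rw [complexity_eq_zero_of_map q (hL ▸ h0)]
    exact Nat.zero_le _
  · have hd1 : 1 ≤ d := Module.finrank_pos
    have e1 : d ^ 2 * L ≤ d ^ 3 * L :=
      Nat.mul_le_mul_right _ (Nat.pow_le_pow_right hd1 (by norm_num))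
    have e2 : d * L ≤ d ^ 3 * L := Nat.mul_le_mul_right _ (Nat.le_self_pow (by norm_num) d)
    have e3 : d ≤ d ^ 3 * L :=
      (Nat.le_self_pow (by norm_num) d).trans (Nat.le_mul_of_pos_right _ hpos)
    calc complexity q ≤ (5 * d ^ 3 + 6 * d ^ 2 + 2 * d) * L + 3 * d := hmain
      _ = 5 * (d ^ 3 * L) + 6 * (d ^ 2 * L) + 2 * (d * L) + 3 * d := by ring
      _ ≤ 5 * (d ^ 3 * L) + 6 * (d ^ 3 * L) + 2 * (d ^ 3 * L) + 3 * (d ^ 3 * L) := by linarith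
      _ = 16 * d ^ 3 * L := by ring

/-- **Weil restriction of scalars for circuit complexity**: for a finite field extension `E/F`
of degree `d` and any `f ∈ F[x_σ]`, `L_F(f) ≤ 16 d³ L_E(f ⊗_F E)` — simulate each
`E`-operation on `F`-coordinates in a basis (structure constants, `O(d³)` per product) and output
the coefficient of `1` (Hrubeš–Yehudayoff 2011, Thm 4.2, field-extension case; Bürgisser 2000
§4.1). [cite: HrubesYehudayoff2011, Thm 4.2] -/
theorem complexity_le_finrank_pow_three_mul {F E : Type*} [Field F] [Field E] [Algebra F E]
    [FiniteDimensional F E] {σ : Type*} (f : MvPolynomial σ F) :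
    complexity f ≤ 16 * Module.finrank F E ^ 3 *
      complexity (MvPolynomial.map (algebraMap F E) f) := by
  classical
  obtain ⟨n, e, he, q, rfl⟩ := exists_fin_rename f
  rw [MvPolynomial.map_rename, complexity_rename_of_injective_holds he,
    complexity_rename_of_injective_holds he]
  exact complexity_le_finrank_pow_three_mul_fin q

end Literature.Computability.AlgebraicComplexity

end
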